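import Literature.MathematicalPhysics.QuantumFieldTheory.Balaban1983to89.B15ComplexifiedDatumFamily

/-!
# `Balaban1983to89.B15Prop1MinimiserFamilyPatching` — [Balaban1989LargeFieldI] = «[IV]», Prop. 1 p. 194 (last clause), (1.74) p. 192; [Balaban1985Variational] = «[15]»,
# Thm 1 p. 279, Prop. 9 (190) p. 309; [Balaban1988Convergent] = «[III]», (2.12) p. 256:
# (J0′) WITH ITS UNIFORM RADIUS FROM LOCAL HOLOMORPHIC MINIMISER CHARTS — «PATCHING» BY COMPACTNESS OF `SU(2)^{bonds}`

Honest framing: statement-level skeleton of published theorems with citation tags; proofs where landed; nothing here is a claim about the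
Yang–Mills mass gap.  Cell `pub-ymgap`, HUMAN RULING D-0149 (width seats), seat `pub-ymgap-dag-n12-w1` (g2; N12 = [B15]; U1a⁺ of the w1 lineage, U1A-CENSUS §4 item 1);
count-neutral; N12 NOT discharged; finite 𝕋⁴ at fixed ε; nothing continuum ∕ OS ∕ mass-gap ∕ Clay.

WHY.  The intrinsic analytic letter (J0′) `hMin` of the N12∕s1 endpoints (`B15Prop1JointHolomorphyFromMinimiserFamily[OneSided]`, this seat g0) asks, per instance, for
ONE radius `R` such that for EVERY `eR`-regular `V_k` a holomorphic bounded `M₂(ℂ)`-family of (2.12) minimisers lives on the complex sup-ball `ball 0 R` of the chart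
parameters `z = (p, B′)`.  Print's `R` ([15] Prop. 9 p. 309 *«U_k(V) … has an extension to an analytic function of Gᶜ-valued small configurations V′»*, [IV] Prop. 1) is an
absolute constant because [15] Sects C–G are quantitative.  The qualitative kernel route of this lineage — the complex implicit-function theorem at a nondegenerate gauge-fixed
minimiser, `Literature.Analysis.Calculus.ConstrainedCriticalFamily` — produces holomorphic families of critical points only LOCALLY: near ONE base datum, with a radius that
depends on the base point.  THIS MODULE is the junction between the two: uniformity of the radius over the base configurations `V_k` comes from COMPACTNESS —
`GaugeField P k SU2 = SU(2)^{bonds}` is compact, the complexified level-0 datum `(z, V_k) ↦ Q_k^{s*}(exp(iB′)·ext(exp(ip)V_k))` (`B15ComplexifiedDatumFamily.datumC`, entire: the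
level-0 pull-back carries no guard) is jointly continuous, so finitely many local charts cover the base data and ONE radius serves every `V_k` (the tube lemma).

CONTENTS (theorems only; no `def`, no `instance`, no `sorry`).
* §1 (private helper) `exists_uniform_radius_of_isCompact` — point-set topology [folklore]: a compact set `K` of base points, a datum map `d : Z → S → M` continuous at `(z₀, s)` for `s ∈ K`,
  and at every `s ∈ K` an OPEN `O ∋ d z₀ s` with a property `Good O` ⇒ ONE radius `R > 0` such that every `s ∈ K` has a good `O` containing `d z s` for all `z ∈ ball z₀ R`.
* §2 ★★ `exists_minimiserFamily_of_localCharts` — the generic assembly: a datum space `M`, a datum `D : (parameters) → (base configurations) → M` holomorphic in the parameters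
  and jointly continuous, a real configuration map `cfg`, and LOCAL HOLOMORPHIC MINIMISER CHARTS `Γ` on `M` at every base configuration of a compact `K` ⇒ the three clauses of
  (J0′) VERBATIM with `∃ R > 0` in front, the same `R` for every `V_k ∈ K`.
* §3 `differentiable_datumC_joint`, `continuous_datumC_coeField` (joint ℂ-differentiability ∕ continuity of the complexified datum in `(z, V_k)`), ★★★ `hMin_of_localCharts` — §2 at
  NODE 00's shapes: `M := PBond P 0 → M₂(ℂ)` (level-0 complex configurations), `D := datumC Λ lo hi ∘ coeField`, `cfg := Q_k^{s*}(exp(iB′)·ext(exp(ip)V_k))`; the conclusion is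
  literally the body of p586362's ∕ p589595's `hMin` (any averaging `av`, class `reg`, determining set `𝔹`) with ONE `R` for all `V_k ∈ K` (`K` compact and arbitrary: `univ`, or
  any compact set containing the `eR`-regular `V_k`).
HONEST SCOPE: STRUCTURE ONLY (point-set topology + the chain rule); the local charts are a DISPLAYED hypothesis — to be inhabited by the complex-IFT route (local MINIMISER charts ⇐
local CRITICAL charts in the class + [15] Thm 1's clause «a unique critical orbit in the space (6)»; local critical charts ⇐ `exists_criticalFamily_tangent` over `ℂ` + nondegeneracy
+ «DΦ onto» + conjugation-equivariance); compactness yields NO explicit radius; nothing of Bałaban's is asserted.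
-/

noncomputable section

namespace Literature.MathematicalPhysics.QuantumFieldTheory.Balaban1983to89.B15Prop1MinimiserFamilyPatching

open Set Metric Filter
open _root_.Topology
open Literature.MathematicalPhysics.QuantumFieldTheory.Balaban1983to89.Node00 (SU coeField coeField_apply)
open B15ComplexifiedDatumFamily (cfgC datumC differentiable_datumC)
open B15SU2ChartHolomorphic (expMulC differentiableAt_expMulC differentiable_qsstarGIter0)
open B15ExtensionHolomorphic (extC differentiable_extC)
open Literature.MathematicalPhysics.QuantumFieldTheory.BalabanImbrieJaffe1984to88.BIJ85Eq453GaugeField (qsstarGIter0)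
open B15Prop1AnalyticExtClause (cplxVec norm_cplxVec)
open B15Prop1ChartCalculusSU2 (E3)
open B15Prop1ChartSU2 (su2Chart)
open B16Sect1Backgrounds (expMul)
open T4CubeChartGnomonic (SU2)
open T4Continuum B15DeterminingSets GaugeField
open scoped Matrix.Norms.L2Operator

/-! ## §1  Point-set topology: one radius for a compact family of base points (tube lemma) -/

section Topology

variable {Z S M : Type*} [PseudoMetricSpace Z] [TopologicalSpace S] [TopologicalSpace M]

/-- **ONE RADIUS FOR A COMPACT SET OF BASE POINTS** (tube lemma ∕ finite subcover).  Let `d : Z → S → M` be continuous at `(z₀, s)` for every `s` of a compact set `K`, and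
suppose that at every `s ∈ K` some OPEN set `O ∋ d z₀ s` has a property `Good`.  Then there is ONE radius `R > 0` such that every `s ∈ K` admits a good `O` containing `d z s`
for ALL `z ∈ ball z₀ R` (for each `s` a product neighbourhood `ball z₀ ε_s × B_s` is mapped into `O_s`; finitely many `B_s` cover `K`; `R = min ε_s`).  Private: a generic
point-set lemma (the tube lemma, cf. Mathlib `generalized_tube_lemma`) kept as this file's helper. [folklore] -/
private theorem exists_uniform_radius_of_isCompact {d : Z → S → M} {z₀ : Z} {K : Set S} (hK : IsCompact K) (Good : Set M → Prop)
    (hcont : ∀ s ∈ K, ContinuousAt (Function.uncurry d) (z₀, s))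
    (hloc : ∀ s ∈ K, ∃ O : Set M, IsOpen O ∧ d z₀ s ∈ O ∧ Good O) :
    ∃ R : ℝ, 0 < R ∧ ∀ s ∈ K, ∃ O : Set M, Good O ∧ ∀ z ∈ ball z₀ R, d z s ∈ O := by
  classical
  have key : ∀ s ∈ K, ∃ O : Set M, Good O ∧ ∃ ε : ℝ, 0 < ε ∧ ∃ B : Set S, B ∈ 𝓝 s ∧
      ∀ z ∈ ball z₀ ε, ∀ s' ∈ B, d z s' ∈ O := by
    intro s hs
    obtain ⟨O, hO, hmem, hgood⟩ := hloc s hs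
    have h : (Function.uncurry d) ⁻¹' O ∈ 𝓝 (z₀, s) := (hcont s hs).preimage_mem_nhds (hO.mem_nhds hmem)
    obtain ⟨A, hA, B, hB, hAB⟩ := mem_nhds_prod_iff.1 h
    obtain ⟨ε, hε, hεA⟩ := Metric.mem_nhds_iff.1 hA
    exact ⟨O, hgood, ε, hε, B, hB, fun z hz s' hs' => hAB (mk_mem_prod (hεA hz) hs')⟩
  choose! O hgood ε hε B hB hOB using key
  obtain ⟨t, htK, hcover⟩ := hK.elim_nhds_subcover B fun s hs => hB s hs
  by_cases ht : t.Nonempty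
  · obtain ⟨s₁, hs₁, hmin⟩ := t.exists_min_image ε ht
    refine ⟨ε s₁, hε s₁ (htK s₁ hs₁), fun s hs => ?_⟩
    obtain ⟨s', hs't, hss'⟩ : ∃ s' ∈ t, s ∈ B s' := by simpa only [mem_iUnion, exists_prop] using hcover hs
    exact ⟨O s', hgood s' (htK s' hs't), fun z hz => hOB s' (htK s' hs't) z (ball_subset_ball (hmin s' hs't) hz) s hss'⟩
  · refine ⟨1, one_pos, fun s hs => ?_⟩
    have h := hcover hs
    rw [Finset.not_nonempty_iff_eq_empty.1 ht] at h
    simp at h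

end Topology

/-! ## §2  The generic assembly: local holomorphic minimiser charts on a datum space ⇒ (J0′) with one radius -/

section Generic

variable {P : Params} {k : ℕ} {M : Type*} [NormedAddCommGroup M] [NormedSpace ℂ M]

/-- ★★ **(J0′) WITH ONE RADIUS FROM LOCAL HOLOMORPHIC MINIMISER CHARTS** (generic datum space).  Data: an averaging family `av`, a class `reg`, a determining set `𝔹` (the (2.12)
problem), a datum space `M` with a datum map `D : (p, B′) ↦ V_k ↦ D (p,B′) V_k` that is ℂ-differentiable in the chart parameters and jointly continuous at `((0,0), V_k)`, the real
level-0 configuration `cfg p B′ V_k` whose (2.12) datum is `avgFamily av (cfg p B′ V_k)`, and a compact set `K` of base configurations.  Hypothesis (LOCAL CHARTS): at every `V_k ∈ K`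
an open `O ∋ D 0 V_k` and a chart `Γ : M → (bond ↦ M₂(ℂ))` with entries ℂ-differentiable on `O`, bounded by `𝓐₀` on `O`, and such that at every REAL datum `D (p,B′) V′_k ∈ O` the
matrix field `Γ (D (p,B′) V′_k)` IS some `SU(2)` configuration that is a minimal configuration (`IsMinimizer`) of the (2.12) problem of the datum of `cfg p B′ V′_k`.  Conclusion:
ONE radius `R > 0` such that for EVERY `V_k ∈ K` the three clauses of the letter (J0′) hold on the sup-ball `ball 0 R` — print's «analytic function of Gᶜ-valued small configurations
V′» with a uniform smallness, here by compactness (no explicit `R`). [cite: Balaban1985Variational, Prop. 9 (190) p.309, Thm 1 p.279; Balaban1989LargeFieldI, Prop. 1 p.194 (last clause), (1.74) p.192; Balaban1988Convergent, (2.12) p.256] -/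
theorem exists_minimiserFamily_of_localCharts (av : ∀ j, Averaging P j SU2) (reg : Set (GaugeField P 0 SU2)) (𝔹 : DetSet P)
    (D : VecField P k (EuclideanSpace ℂ (Fin 3)) × VecField P k (EuclideanSpace ℂ (Fin 3)) → GaugeField P k SU2 → M)
    (cfg : VecField P k E3 → VecField P k E3 → GaugeField P k SU2 → GaugeField P 0 SU2)
    {K : Set (GaugeField P k SU2)} (hK : IsCompact K) {𝓐₀ : ℝ}
    (hcont : ∀ Vk ∈ K, ContinuousAt (Function.uncurry D) (0, Vk))
    (hhol : ∀ Vk ∈ K, Differentiable ℂ fun z => D z Vk)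
    (hloc : ∀ Vk ∈ K, ∃ O : Set M, IsOpen O ∧ D 0 Vk ∈ O ∧
      ∃ Γ : M → PBond P 0 → Matrix (Fin 2) (Fin 2) ℂ,
        (∀ b a c, DifferentiableOn ℂ (fun m => Γ m b a c) O) ∧
        (∀ m ∈ O, ∀ b a c, ‖Γ m b a c‖ ≤ 𝓐₀) ∧
        ∀ (p B' : VecField P k E3) (Vk' : GaugeField P k SU2), D (cplxVec p, cplxVec B') Vk' ∈ O →
          ∃ U' : GaugeField P 0 SU2, (∀ b, Γ (D (cplxVec p, cplxVec B') Vk') b = ((U' b : SU2) : Matrix (Fin 2) (Fin 2) ℂ)) ∧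
            IsMinimizer av reg 𝔹 (avgFamily av (cfg p B' Vk')) U') :
    ∃ R : ℝ, 0 < R ∧ ∀ Vk ∈ K,
      ∃ Ũ : VecField P k (EuclideanSpace ℂ (Fin 3)) × VecField P k (EuclideanSpace ℂ (Fin 3)) → PBond P 0 → Matrix (Fin 2) (Fin 2) ℂ,
        (∀ b a c, DifferentiableOn ℂ (fun z => Ũ z b a c) (ball 0 R)) ∧
        (∀ z ∈ ball (0 : VecField P k (EuclideanSpace ℂ (Fin 3)) × VecField P k (EuclideanSpace ℂ (Fin 3))) R, ∀ b a c, ‖Ũ z b a c‖ ≤ 𝓐₀) ∧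
        ∀ p B' : VecField P k E3, ‖p‖ < R → ‖B'‖ < R → ∃ U' : GaugeField P 0 SU2,
          (∀ b, Ũ (cplxVec p, cplxVec B') b = ((U' b : SU2) : Matrix (Fin 2) (Fin 2) ℂ)) ∧
            IsMinimizer av reg 𝔹 (avgFamily av (cfg p B' Vk)) U' := by
  -- the good charts: a chart `Γ` with the three properties on `O`
  obtain ⟨R, hR, hall⟩ := exists_uniform_radius_of_isCompact (d := D) (z₀ := 0) hK
    (fun O => ∃ Γ : M → PBond P 0 → Matrix (Fin 2) (Fin 2) ℂ,
        (∀ b a c, DifferentiableOn ℂ (fun m => Γ m b a c) O) ∧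
        (∀ m ∈ O, ∀ b a c, ‖Γ m b a c‖ ≤ 𝓐₀) ∧
        ∀ (p B' : VecField P k E3) (Vk' : GaugeField P k SU2), D (cplxVec p, cplxVec B') Vk' ∈ O →
          ∃ U' : GaugeField P 0 SU2, (∀ b, Γ (D (cplxVec p, cplxVec B') Vk') b = ((U' b : SU2) : Matrix (Fin 2) (Fin 2) ℂ)) ∧
            IsMinimizer av reg 𝔹 (avgFamily av (cfg p B' Vk')) U')
    hcont (fun Vk hVk => hloc Vk hVk)
  refine ⟨R, hR, fun Vk hVk => ?_⟩
  obtain ⟨O, ⟨Γ, hΓd, hΓb, hΓr⟩, hmaps⟩ := hall Vk hVk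
  refine ⟨fun z => Γ (D z Vk), fun b a c => ?_, fun z hz b a c => hΓb _ (hmaps z hz) b a c, fun p B' hp hB' => ?_⟩
  · exact (hΓd b a c).comp (hhol Vk hVk).differentiableOn fun z hz => hmaps z hz
  · have hz : (cplxVec p, cplxVec B') ∈ ball (0 : VecField P k (EuclideanSpace ℂ (Fin 3)) × VecField P k (EuclideanSpace ℂ (Fin 3))) R := by
      rw [mem_ball_zero_iff, Prod.norm_def, norm_cplxVec, norm_cplxVec]
      exact max_lt hp hB'
    exact hΓr p B' Vk (hmaps _ hz)

end Generic

/-! ## §3  At NODE 00's shapes: the complexified level-0 datum `datumC` and the letter `hMin` of p586362 ∕ p589595 -/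

section Record

variable {P : Params} {k : ℕ} (Λ : Set (Site P k)) (lo hi : Fin P.d → ℤ)

/-- **JOINT ℂ-DIFFERENTIABILITY OF THE COMPLEXIFIED DATUM** in the chart parameters `z = (p, B′)` AND the (complex) base field `W`: `(z, W) ↦ Q_k^{s*}(exp(iB′)·ext(exp(ip)W))` is
ℂ-differentiable everywhere (products, entire `exp`, the cut-off and the pull-back are polynomial ∕ entire in the entries). [cite: Balaban1985Variational, Prop. 9 (190) p.309; Balaban1989LargeFieldI, Prop. 1 p.194] -/
theorem differentiable_datumC_joint :
    Differentiable ℂ (fun w : (VecField P k (EuclideanSpace ℂ (Fin 3)) × VecField P k (EuclideanSpace ℂ (Fin 3))) ×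
        (PBond P k → Matrix (Fin 2) (Fin 2) ℂ) => datumC Λ lo hi w.2 w.1.1 w.1.2) := by
  have hcfg : Differentiable ℂ (fun w : (VecField P k (EuclideanSpace ℂ (Fin 3)) × VecField P k (EuclideanSpace ℂ (Fin 3))) ×
      (PBond P k → Matrix (Fin 2) (Fin 2) ℂ) => cfgC Λ lo hi w.2 w.1.1 w.1.2) := by
    intro w
    unfold cfgC
    have h1 : DifferentiableAt ℂ (fun w : (VecField P k (EuclideanSpace ℂ (Fin 3)) × VecField P k (EuclideanSpace ℂ (Fin 3))) ×
        (PBond P k → Matrix (Fin 2) (Fin 2) ℂ) => expMulC w.1.1 w.2) w :=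
      differentiableAt_expMulC differentiableAt_fst.fst differentiableAt_snd
    have h2 : DifferentiableAt ℂ ((fun V : PBond P k → Matrix (Fin 2) (Fin 2) ℂ => extC Λ lo hi V) ∘
        fun w : (VecField P k (EuclideanSpace ℂ (Fin 3)) × VecField P k (EuclideanSpace ℂ (Fin 3))) ×
          (PBond P k → Matrix (Fin 2) (Fin 2) ℂ) => expMulC w.1.1 w.2) w :=
      ((differentiable_extC Λ lo hi) _).comp w h1
    exact differentiableAt_expMulC differentiableAt_fst.snd h2
  have h := (differentiable_qsstarGIter0 (P := P) (N := 2) k).comp hcfg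
  exact h

/-- The matrix field of an `SU(2)` configuration depends continuously on the configuration. [cite: Balaban1987RG1, (0.2) p.252 (bookkeeping)] -/
theorem continuous_coeField {j : ℕ} : Continuous (coeField : GaugeField P j SU2 → PBond P j → Matrix (Fin 2) (Fin 2) ℂ) :=
  continuous_pi fun b => continuous_subtype_val.comp (continuous_apply b)

/-- **JOINT CONTINUITY OF THE COMPLEXIFIED DATUM IN `(z, V_k)`** along `SU(2)` base fields (through the continuous `coeField`). [cite: Balaban1985Variational, Prop. 9 (190) p.309 (bookkeeping)] -/
theorem continuous_datumC_coeField :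
    Continuous (Function.uncurry fun (z : VecField P k (EuclideanSpace ℂ (Fin 3)) × VecField P k (EuclideanSpace ℂ (Fin 3))) (Vk : GaugeField P k SU2) =>
      datumC Λ lo hi (coeField Vk) z.1 z.2) := by
  have h := (differentiable_datumC_joint Λ lo hi).continuous.comp (continuous_fst.prodMk (continuous_coeField.comp continuous_snd))
  exact h

/-- ★★★ **THE LETTER (J0′) `hMin` OF p586362 ∕ p589595 WITH ONE RADIUS, FROM LOCAL HOLOMORPHIC MINIMISER CHARTS ON THE LEVEL-0 COMPLEX CONFIGURATION SPACE.**  For the chart family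
`(p, B′) ↦ Q_k^{s*}(exp(iB′)·ext(exp(ip)V_k))` of [IV] Prop. 1 (any averaging `av`, class `reg`, determining set `𝔹` for the (2.12) problem; `ext` free), a compact set `K` of base fields
`V_k` (e.g. `univ`: `SU(2)^{bonds}` is compact), and at every `V_k ∈ K` a LOCAL CHART: an open `O` of `PBond P 0 → M₂(ℂ)` containing the complexified datum `datumC Λ lo hi ↑V_k 0 0` and
`Γ` with entries ℂ-differentiable on `O`, bounded by `𝓐₀` on `O`, and which at every REAL point `datumC Λ lo hi ↑V′_k (p, B′) ∈ O` IS some `SU(2)` configuration minimal for the datum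
`avgFamily av (Q_k^{s*}(exp(iB′)·ext(exp(ip)V′_k)))` — THEN there is ONE `R > 0` such that for EVERY `V_k ∈ K`: «∃ Ũ on `ball 0 R` with ℂ-differentiable entries bounded by `𝓐₀` which
at every real `(p, B′)`, `‖p‖, ‖B′‖ < R`, IS SOME (2.12) MINIMISER of that point's datum» — the body of `hMin`.  The charts are what the complex implicit-function route supplies
locally ([15] Prop. 9 ∕ Sect. G); the uniform `R` of print is here qualitative (compactness). [cite: Balaban1985Variational, Thm 1 p.279, Prop. 9 (190) p.309; Balaban1989LargeFieldI, (1.74) p.192, Prop. 1 p.194 (last clause); Balaban1988Convergent, (2.11)–(2.14) pp.256–257] -/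
theorem hMin_of_localCharts (av : ∀ j, Averaging P j SU2) (reg : Set (GaugeField P 0 SU2)) (𝔹 : DetSet P)
    (ext : GaugeField P k SU2 → GaugeField P k SU2) {K : Set (GaugeField P k SU2)} (hK : IsCompact K) {𝓐₀ : ℝ}
    (hloc : ∀ Vk ∈ K, ∃ O : Set (PBond P 0 → Matrix (Fin 2) (Fin 2) ℂ), IsOpen O ∧
      datumC Λ lo hi (coeField Vk) (0 : VecField P k (EuclideanSpace ℂ (Fin 3))) (0 : VecField P k (EuclideanSpace ℂ (Fin 3))) ∈ O ∧
      ∃ Γ : (PBond P 0 → Matrix (Fin 2) (Fin 2) ℂ) → PBond P 0 → Matrix (Fin 2) (Fin 2) ℂ,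
        (∀ b a c, DifferentiableOn ℂ (fun Q => Γ Q b a c) O) ∧
        (∀ Q ∈ O, ∀ b a c, ‖Γ Q b a c‖ ≤ 𝓐₀) ∧
        ∀ (p B' : VecField P k E3) (Vk' : GaugeField P k SU2), datumC Λ lo hi (coeField Vk') (cplxVec p) (cplxVec B') ∈ O →
          ∃ U' : GaugeField P 0 SU2,
            (∀ b, Γ (datumC Λ lo hi (coeField Vk') (cplxVec p) (cplxVec B')) b = ((U' b : SU2) : Matrix (Fin 2) (Fin 2) ℂ)) ∧
              IsMinimizer av reg 𝔹 (avgFamily av (qsstarGIter0 k (expMul su2Chart B' (ext (expMul su2Chart p Vk'))))) U') :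
    ∃ R : ℝ, 0 < R ∧ ∀ Vk ∈ K,
      ∃ Ũ : VecField P k (EuclideanSpace ℂ (Fin 3)) × VecField P k (EuclideanSpace ℂ (Fin 3)) → PBond P 0 → Matrix (Fin 2) (Fin 2) ℂ,
        (∀ b a c, DifferentiableOn ℂ (fun z => Ũ z b a c) (ball 0 R)) ∧
        (∀ z ∈ ball (0 : VecField P k (EuclideanSpace ℂ (Fin 3)) × VecField P k (EuclideanSpace ℂ (Fin 3))) R, ∀ b a c, ‖Ũ z b a c‖ ≤ 𝓐₀) ∧
        ∀ p B' : VecField P k E3, ‖p‖ < R → ‖B'‖ < R → ∃ U' : GaugeField P 0 SU2,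
          (∀ b, Ũ (cplxVec p, cplxVec B') b = ((U' b : SU2) : Matrix (Fin 2) (Fin 2) ℂ)) ∧
            IsMinimizer av reg 𝔹 (avgFamily av (qsstarGIter0 k (expMul su2Chart B' (ext (expMul su2Chart p Vk))))) U' := by
  refine exists_minimiserFamily_of_localCharts av reg 𝔹
    (fun z Vk => datumC Λ lo hi (coeField Vk) z.1 z.2)
    (fun p B' Vk => qsstarGIter0 k (expMul su2Chart B' (ext (expMul su2Chart p Vk)))) hK
    (fun Vk _ => (continuous_datumC_coeField Λ lo hi).continuousAt)
    (fun Vk _ => (differentiable_datumC Λ lo hi (coeField Vk)))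
    (fun Vk hVk => ?_)
  obtain ⟨O, hO, h0, Γ, hΓ⟩ := hloc Vk hVk
  exact ⟨O, hO, h0, Γ, hΓ⟩

end Record

end Literature.MathematicalPhysics.QuantumFieldTheory.Balaban1983to89.B15Prop1MinimiserFamilyPatching

end
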